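import Literature.NumberTheory.Automorphic.GL2CCoeffOps
import Literature.NumberTheory.Automorphic.GL2CBiModuleIntertwiner
import Literature.NumberTheory.Automorphic.ImaginaryQuadraticArchimedeanGL
import Literature.NumberTheory.DiophantineGeometry.WeylModuleOneRowForms
import Literature.RingTheory.HilbertSamuel.PolynomialRing
import HarnessLib

/-!
# The coefficient module `E_λ(ℂ)` of `Res GL₂` over an imaginary quadratic field is the
# coordinate model `Sym^d ⊗ \overline{Sym}^d`

* `finrank_coeffModule_two` — **`dim V_λ(ℂ) = d + 1`** for `GL₂`, `d = λ₀ − λ₁` (the Weyl module of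
  the one-row partition `(d)` is `Sym^d(ℂ²)`: `weylFormLinearEquiv` and the count of monomials
  `finrank_homogeneousSubmodule_fin`);
* `finrank_resCoeffModule_two` — **`dim E_λ(ℂ) = ∏_τ (d_τ + 1)`** (`Basis.piTensorProduct`);
* `ImaginaryQuadratic.univ_embeddings` — the embeddings of a totally complex field with one infinite
  place are `{σ₀, σ̄₀}`; hence `dim E_λ(ℂ) = (d_{σ₀} + 1)(d_{σ̄₀} + 1)`;
* `exists_coeffModelEquiv` — for `d_{σ̄₀} = d_{σ₀} = d` (forced by the existence of the cohomological
  `π`, `GL2CCuspFormLowestKType`), **a linear isomorphism `Θ : GL2CESH.model ℂ d ≃ E_λ(ℂ)`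
  intertwining the coordinate operators `GL2CESH.coeff d` with the six operators `coeffOps K λ w₀`**
  (`GL2CKType.Ops.exists_modelEquiv` fed with `casL_coeffOps`, `casR_coeffOps`).
[cite: FultonHarrisGTM129, §11.1 and §15.5] [cite: Knapp2002, §V.4]

Theorems only; no named fact.
-/

noncomputable section

open scoped ComplexConjugate TensorProduct BigOperators
open Complex Module

namespace Literature.NumberTheory.Automorphic

namespace GL2CCoeff

open scoped Classical
open _root_.NumberField _root_.NumberField.InfinitePlace
open RealMatrixGroup GLnCohomology Literature.NumberTheory.DiophantineGeometry Literature.RingTheory.HilbertSamuel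
open ResGLnCohomology GL2CKType MvPolynomial

/-! ### Dimensions -/

/-- **`dim V_λ(ℂ) = d + 1` for `GL₂`**, `d = (λ₀ − λ₁)⁺`. [cite: FultonHarrisGTM129, §15.5] -/
theorem finrank_coeffModule_two (wt : Fin 2 → ℤ) :
    Module.finrank ℂ (GLnCohomology.CoeffModule ℂ 2 wt) = (wt 0 - wt 1).toNat + 1 := by
  change Module.finrank ℂ ↥(weylModule ℂ (Fin 2) (coeffPartition wt)) = _
  rw [ComplexPlace.coeffPartition_two wt, (weylFormLinearEquiv ℂ (coeffDegree wt)).finrank_eq,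
    finrank_homogeneousSubmodule_fin, ComplexPlace.coeffDegree_two]
  rw [show (wt 0 - wt 1).toNat + 2 - 1 = (wt 0 - wt 1).toNat + 1 by omega, Nat.choose_succ_self_right]

/-- **`dim E_λ(ℂ) = ∏_τ (d_τ + 1)`.** [cite: FultonHarrisGTM129, §15.5] -/
theorem finrank_resCoeffModule_two (K : Type) [Field K] [NumberField K] (lam : (K →+* ℂ) → Fin 2 → ℤ) :
    Module.finrank ℂ (ResGLnCohomology.CoeffModule ℂ 2 K lam) = ∏ τ : K →+* ℂ, ((lam τ 0 - lam τ 1).toNat + 1) := by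
  change Module.finrank ℂ (⨂[ℂ] τ : (K →+* ℂ), GLnCohomology.CoeffModule ℂ 2 (lam τ)) = _
  haveI : ∀ τ : K →+* ℂ, FiniteDimensional ℂ (GLnCohomology.CoeffModule ℂ 2 (lam τ)) := fun τ =>
    ParallelWeight.finiteDimensional_coeffModule 2 (lam τ)
  let b := Basis.piTensorProduct (R := ℂ) fun τ : K →+* ℂ => Module.finBasis ℂ (GLnCohomology.CoeffModule ℂ 2 (lam τ))
  rw [Module.finrank_eq_card_basis b, Fintype.card_pi]
  refine Finset.prod_congr rfl fun τ _ => ?_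
  rw [Fintype.card_fin, finrank_coeffModule_two]

end GL2CCoeff

namespace ImaginaryQuadratic

open scoped Classical
open _root_.NumberField _root_.NumberField.InfinitePlace

variable (K : Type) [Field K] [NumberField K] [IsTotallyComplex K]

/-- With a single infinite place, **the complex embeddings are `σ₀` and `σ̄₀`**. [folklore] -/
theorem univ_embeddings (hK : Subsingleton (InfinitePlace K)) :
    (Finset.univ : Finset (K →+* ℂ)) =
      {(complexPlace K).1.embedding, ComplexEmbedding.conjugate (complexPlace K).1.embedding} := by
  ext τ
  simp only [Finset.mem_univ, Finset.mem_insert, Finset.mem_singleton, true_iff]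
  have h : InfinitePlace.mk τ = (complexPlace K).1 := Subsingleton.elim _ _
  exact ComplexPlace.eq_or_eq_of_mk_eq (complexPlace K) h

/-- Hence **`dim E_λ(ℂ) = (d_{σ₀} + 1)(d_{σ̄₀} + 1)`.** [cite: FultonHarrisGTM129, §15.5] -/
theorem finrank_resCoeffModule (hK : Subsingleton (InfinitePlace K)) (lam : (K →+* ℂ) → Fin 2 → ℤ) :
    Module.finrank ℂ (ResGLnCohomology.CoeffModule ℂ 2 K lam) =
      ((lam (complexPlace K).1.embedding 0 - lam (complexPlace K).1.embedding 1).toNat + 1) *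
        ((lam (ComplexEmbedding.conjugate (complexPlace K).1.embedding) 0 -
          lam (ComplexEmbedding.conjugate (complexPlace K).1.embedding) 1).toNat + 1) := by
  classical
  rw [GL2CCoeff.finrank_resCoeffModule_two, univ_embeddings K hK,
    Finset.prod_pair (ComplexPlace.conjugate_embedding_ne (complexPlace K)).symm]

end ImaginaryQuadratic

namespace GL2CCoeff

open scoped Classical
open _root_.NumberField _root_.NumberField.InfinitePlace ImaginaryQuadratic
open RealMatrixGroup GLnCohomology ResGLnCohomology GL2CKType Literature.NumberTheory.DiophantineGeometry

variable (K : Type) [Field K] [NumberField K] [IsTotallyComplex K]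

/-- **`E_λ(ℂ) ≅ Sym^d ⊗ \overline{Sym}^d` compatibly with the six operators** (imaginary quadratic `K`,
`λ_{σ₀}`, `λ_{σ̄₀}` dominant with the same `d = d_{σ₀} = d_{σ̄₀}`). [cite: FultonHarrisGTM129, §11.1]
[cite: Knapp2002, §V.4] -/
theorem exists_coeffModelEquiv (hK : Subsingleton (InfinitePlace K)) (lam : (K →+* ℂ) → Fin 2 → ℤ)
    (hdom : Weight.IsDominant (lam (complexPlace K).1.embedding))
    (hdom' : Weight.IsDominant (lam (ComplexEmbedding.conjugate (complexPlace K).1.embedding))) {d : ℕ}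
    (hd₀ : (lam (complexPlace K).1.embedding 0 - lam (complexPlace K).1.embedding 1).toNat = d)
    (hd₁ : (lam (ComplexEmbedding.conjugate (complexPlace K).1.embedding) 0 -
        lam (ComplexEmbedding.conjugate (complexPlace K).1.embedding) 1).toNat = d) :
    ∃ Θ : GL2CESH.model ℂ d ≃ₗ[ℂ] ResGLnCohomology.CoeffModule ℂ 2 K lam,
      (∀ u, Θ ((GL2CESH.coeff (C := ℂ) d).LE u) = (coeffOps K lam (complexPlace K)).LE (Θ u)) ∧
      (∀ u, Θ ((GL2CESH.coeff (C := ℂ) d).LF u) = (coeffOps K lam (complexPlace K)).LF (Θ u)) ∧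
      (∀ u, Θ ((GL2CESH.coeff (C := ℂ) d).LH u) = (coeffOps K lam (complexPlace K)).LH (Θ u)) ∧
      (∀ u, Θ ((GL2CESH.coeff (C := ℂ) d).RE u) = (coeffOps K lam (complexPlace K)).RE (Θ u)) ∧
      (∀ u, Θ ((GL2CESH.coeff (C := ℂ) d).RF u) = (coeffOps K lam (complexPlace K)).RF (Θ u)) ∧
      (∀ u, Θ ((GL2CESH.coeff (C := ℂ) d).RH u) = (coeffOps K lam (complexPlace K)).RH (Θ u)) := by
  haveI : FiniteDimensional ℂ (ResGLnCohomology.CoeffModule ℂ 2 K lam) := finiteDimensional K lam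
  have hdim := ImaginaryQuadratic.finrank_resCoeffModule K hK lam
  rw [hd₀, hd₁, ← sq] at hdim
  haveI : Nontrivial (ResGLnCohomology.CoeffModule ℂ 2 K lam) :=
    Module.nontrivial_of_finrank_pos (R := ℂ) (by rw [hdim]; positivity)
  have hcL : ∀ v, (coeffOps K lam (complexPlace K)).casL v = ((2 : ℂ)⁻¹ * ((d : ℂ) * ((d : ℂ) + 2))) • v :=
    fun v => by rw [casL_coeffOps K lam _ hdom v, hd₀]
  have hcR : ∀ v, (coeffOps K lam (complexPlace K)).casR v = ((2 : ℂ)⁻¹ * ((d : ℂ) * ((d : ℂ) + 2))) • v :=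
    fun v => by rw [casR_coeffOps K lam _ hdom' v, hd₁]
  exact Ops.exists_modelEquiv (isLawful_coeffOps K lam _) hcL hcR hdim

end GL2CCoeff

end Literature.NumberTheory.Automorphic

end
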